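import Literature.NumberTheory.Automorphic.AdelicHeightGLProofs   -- ★ `GLn.one_le_localHeight`, `GLn.mulSupport_localHeight_finite_holds`, `nnnorm_apply_le_sup`
import Literature.NumberTheory.Automorphic.AdelicVectorHeight      -- ★ `vecHeight`, `vecFinHeight`, `vecArchNorm`, `IsHeightFinite`
import HarnessLib

/-!
# Crux `HLiu418`, Track B road `K2_Liu`, unit U5 «DOUBLING ZETA», socket #16a (organ (IV-c)) — helper «F3»:
# the Borel–Jacquet height of `g ∈ GL_N(𝔸_K)` is dominated by the Godement–Garrett height of the vector `(1, g, g⁻¹)`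

Cell `hodgecm-mathlib`, crux item hLiu418 = `stmt-HodgeConjecture-24832`, route of record `HCCMUnconditional`; squad K2 ∕ K2Liu, prover K2Liu-p04 (g0)
(socket #16a `sig_K2LiuDoublingHeightDecayPointwise`, U5 ED. 6 :242; plan of record K2/STATUS 21:43Z, file (F3)).  THEOREMS ONLY over
★ `Literature/NumberTheory/Automorphic/AdelicGLnGlue` (`adelicHeightGL`, `GLn.archHeight`, `GLn.localHeight`), ★ `AdelicHeightGLProofs`, ★
`AdelicVectorHeight`; GL-generic (any number field `K`, any `g ∈ GL_N(𝔸_K)`, `N ≥ 1`); no `def`, no instance, no notation, no `sorry`; lane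
`--supports stmt-HodgeConjecture-24832 --as helper` (count-neutral).

WHY.  The decay estimate #16a bounds `Φ(ι(g,1))` by a negative power of the Borel–Jacquet height `‖g‖ = H_∞(g) · ∏ᶠ_v H_v(g)` of ★ `AdelicGLnGlue`,
`H_v(g) = max_{i,j} (|g_{ij}|_v ⊔ |(g⁻¹)_{ij}|_v)`, while the Plücker side of the argument (★ F1, F4, F5 = `Theorems/K2LiuPluckerMinors`,
`K2LiuDoublingPluckerCoordinates`, `K2LiuUnitaryInverseHeight`) produces Godement–Garrett heights `h = vecHeight` (★ `AdelicVectorHeight`) of explicit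
adelic vectors, ending with the vector `y_g = (1, (g_{ij}), ((g⁻¹)_{ik}))` of ★ F5 `vecHeight_one_entries_inv_le`.  This file is the bridge
`‖g‖ ≤ h(y_g)` ([BorelJacquet1979, §1.2]: `‖g‖` IS the height of the point `(g, g⁻¹)` of affine space; [Garrett2018, §2.2]):

* §1 vectors with a coordinate `1`: every local height is `≥ 1`, so each archimedean norm is bounded by the archimedean part of the height, and so is
  the mixed-space image `ι((x_i)_∞)` of every coordinate (cf. ★ `TorusIntegrandGL2PhiBound.norm_ringEquiv_mixedSpace_le`);
* §2 `vecFinHeight_one_entries_inv_eq_localHeight` — **`h_v(y_g) = H_v(g)`** EXACTLY at every finite place (`N ≥ 1`), whence `IsHeightFinite y_g` from ★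
  `GLn.mulSupport_localHeight_finite_holds`;
* §3 `archHeight_le_prod_vecArchNorm` — `H_∞(g) ≤ ∏_w ‖y_g‖_w^{mult w}` (the tree's `H_∞` is a sup of sup-norms of `ι((g_{ij})_∞)`, `ι((g⁻¹_{ij})_∞)`);
* §4 **`adelicHeightGL_le_vecHeight`** — `‖g‖ ≤ h(y_g)` for `g ∈ GL_N(𝔸_K)`, `N ≥ 1`.

HONEST LABEL.  Count-neutral helper; `HC_CM` is proved only modulo the 7 printed citations (2 remaining named inputs: hLiu418 =
`stmt-HodgeConjecture-24832`, h413 = `stmt-HodgeConjecture-24833`) until rung 0 closes.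
-/

set_option autoImplicit false
-- the mandated namespace repeats the single-problem summit's segment (`HodgeConjecture.HodgeConjecture`)
set_option linter.dupNamespace false

noncomputable section

open scoped NNReal MatrixGroups Classical
open NumberField NumberField.mixedEmbedding IsDedekindDomain

namespace Summit.HodgeConjecture.HodgeConjecture.Cruxes.HLiu418.K2LiuAdelicHeightGLVsVecHeight

open Literature.NumberTheory.Automorphic

variable {K : Type} [Field K] [NumberField K]

/-! ## §1 Vectors with a coordinate `1` -/

section CoordOne

variable {ι : Type*} [Fintype ι]

/-- If `x i₀ = 1` then `1 ≤ ‖x‖_w` at every infinite place `w`. [folklore] -/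
theorem one_le_vecArchNorm_of_apply_eq_one {x : ι → AdeleRing (𝓞 K) K} (i₀ : ι) (h1 : x i₀ = 1) (w : InfinitePlace K) :
    1 ≤ vecArchNorm K w x := by
  have h := nnnorm_fst_apply_le_vecArchNorm w x i₀
  have e : ((x i₀).1 w) = 1 := by rw [h1]; rfl
  rwa [e, nnnorm_one] at h

/-- If `x i₀ = 1` then `1 ≤ h_v(x)` at every finite place `v`. [folklore] -/
theorem one_le_vecFinHeight_of_apply_eq_one {x : ι → AdeleRing (𝓞 K) K} (i₀ : ι) (h1 : x i₀ = 1) (v : HeightOneSpectrum (𝓞 K)) :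
    1 ≤ vecFinHeight K v x := by
  have h := nnnorm_snd_apply_le_vecFinHeight v x i₀
  have e : ((x i₀).2 v) = 1 := by rw [h1]; rfl
  rwa [e, nnnorm_one] at h

/-- If `x i₀ = 1`, every archimedean norm `‖x‖_w` is bounded by the archimedean part `∏_{w'} ‖x‖_{w'}^{mult w'}` of the height (all factors are `≥ 1`).
[cite: Garrett2018, §2.2 (PDF p. 81)] -/
theorem vecArchNorm_le_prod_of_apply_eq_one {x : ι → AdeleRing (𝓞 K) K} (i₀ : ι) (h1 : x i₀ = 1) (w : InfinitePlace K) :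
    vecArchNorm K w x ≤ ∏ w' : InfinitePlace K, vecArchNorm K w' x ^ w'.mult :=
  calc vecArchNorm K w x ≤ vecArchNorm K w x ^ w.mult :=
        le_self_pow (one_le_vecArchNorm_of_apply_eq_one i₀ h1 w) InfinitePlace.mult_ne_zero
    _ ≤ ∏ w' : InfinitePlace K, vecArchNorm K w' x ^ w'.mult :=
        Finset.single_le_prod' (f := fun w' : InfinitePlace K => vecArchNorm K w' x ^ w'.mult)
          (fun w' _ => one_le_pow_of_one_le' (one_le_vecArchNorm_of_apply_eq_one i₀ h1 w') _) (Finset.mem_univ w)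

open NumberField.InfinitePlace.Completion in
/-- If `x i₀ = 1`, the mixed-space image `ι((x_i)_∞)` of the archimedean component of ANY coordinate `x_i` has sup norm at most the archimedean part of
the height of `x` (`ι = InfiniteAdeleRing.ringEquiv_mixedSpace K : K_∞ ≃+* ℝ^{r₁} × ℂ^{r₂}` is componentwise isometric and the target carries the sup norm,
cf. ★ `TorusIntegrandGL2PhiBound.norm_ringEquiv_mixedSpace_le`, whose ten-line argument is repeated inline to spare that file's import chain).
[cite: Garrett2018, §2.2 (PDF p. 81)] -/
theorem nnnorm_ringEquiv_mixedSpace_fst_le_of_apply_eq_one {x : ι → AdeleRing (𝓞 K) K} (i₀ : ι) (h1 : x i₀ = 1) (i : ι) :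
    ‖InfiniteAdeleRing.ringEquiv_mixedSpace K (x i).1‖₊ ≤ ∏ w : InfinitePlace K, vecArchNorm K w x ^ w.mult := by
  rw [← NNReal.coe_le_coe, coe_nnnorm]
  have hR : (0 : ℝ) ≤ ((∏ w : InfinitePlace K, vecArchNorm K w x ^ w.mult : ℝ≥0) : ℝ) := NNReal.coe_nonneg _
  have h : ∀ w : InfinitePlace K, ‖(x i).1 w‖ ≤ ((∏ w : InfinitePlace K, vecArchNorm K w x ^ w.mult : ℝ≥0) : ℝ) := fun w => by
    rw [← coe_nnnorm, NNReal.coe_le_coe]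
    exact (nnnorm_fst_apply_le_vecArchNorm w x i).trans (vecArchNorm_le_prod_of_apply_eq_one i₀ h1 w)
  refine max_le ?_ ?_
  · refine (pi_norm_le_iff_of_nonneg hR).2 fun w => ?_
    have e : ‖(x i).1 w.1‖ = ‖(InfiniteAdeleRing.ringEquiv_mixedSpace K (x i).1).1 w‖ := by
      rw [InfiniteAdeleRing.ringEquiv_mixedSpace_apply]
      exact ((AddMonoidHomClass.isometry_iff_norm _).1 (isometry_extensionEmbeddingOfIsReal w.2) _).symm
    rw [← e]; exact h w.1
  · refine (pi_norm_le_iff_of_nonneg hR).2 fun w => ?_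
    have e : ‖(x i).1 w.1‖ = ‖(InfiniteAdeleRing.ringEquiv_mixedSpace K (x i).1).2 w‖ := by
      rw [InfiniteAdeleRing.ringEquiv_mixedSpace_apply]
      exact ((AddMonoidHomClass.isometry_iff_norm _).1 (isometry_extensionEmbedding w.1) _).symm
    rw [← e]; exact h w.1

end CoordOne

/-! ## §2 Entries of the local components; `h_v(1, g, g⁻¹) = H_v(g)` -/

section Local

variable {n : ℕ}

/-- Entries of the inverse archimedean component: `((g_∞⁻¹)_{ij}) = ι(((g⁻¹)_{ij})_∞)` (for `g_∞` itself this is ★ `GLn.coe_toMixed_apply`, by `rfl`).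
[folklore] -/
theorem toMixed_inv_coe_apply (g : GL (Fin n) (AdeleRing (𝓞 K) K)) (i j : Fin n) :
    (((GLn.toMixed n K g)⁻¹ : GL (Fin n) (mixedSpace K)) : Matrix (Fin n) (Fin n) (mixedSpace K)) i j =
      InfiniteAdeleRing.ringEquiv_mixedSpace K ((((g⁻¹ : GL (Fin n) (AdeleRing (𝓞 K) K)) :
        Matrix (Fin n) (Fin n) (AdeleRing (𝓞 K) K)) i j).1) := by
  rw [← map_inv]; rfl

/-- Entries of the local component at a finite place: `((g_v)_{ij}) = (g_{ij})_v` (definitional). [folklore] -/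
theorem map_adeleEval_coe_apply (v : HeightOneSpectrum (𝓞 K)) (g : GL (Fin n) (AdeleRing (𝓞 K) K)) (i j : Fin n) :
    ((Matrix.GeneralLinearGroup.map (AdelicGroupData.adeleEval K v) g : GL (Fin n) (v.adicCompletion K)) :
        Matrix (Fin n) (Fin n) (v.adicCompletion K)) i j = ((g : Matrix (Fin n) (Fin n) (AdeleRing (𝓞 K) K)) i j).2 v := rfl

/-- Entries of the inverse local component: `((g_v⁻¹)_{ij}) = ((g⁻¹)_{ij})_v` (definitional). [folklore] -/
theorem map_adeleEval_inv_coe_apply (v : HeightOneSpectrum (𝓞 K)) (g : GL (Fin n) (AdeleRing (𝓞 K) K)) (i j : Fin n) :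
    (((Matrix.GeneralLinearGroup.map (AdelicGroupData.adeleEval K v) g)⁻¹ : GL (Fin n) (v.adicCompletion K)) :
        Matrix (Fin n) (Fin n) (v.adicCompletion K)) i j =
      ((((g⁻¹ : GL (Fin n) (AdeleRing (𝓞 K) K)) : Matrix (Fin n) (Fin n) (AdeleRing (𝓞 K) K)) i j).2 v) := by
  rw [← map_inv]; rfl

/-- **`h_v(1, g, g⁻¹) = H_v(g)`** at every finite place, `N ≥ 1`: the tree's local height `H_v(g) = max_{i,j} (|g_{ij}|_v ⊔ |(g⁻¹)_{ij}|_v)` is `≥ 1`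
(★ `GLn.one_le_localHeight`), so adjoining the coordinate `1` does not change the sup. [cite: BorelJacquet1979, §1.2] -/
theorem vecFinHeight_one_entries_inv_eq_localHeight [NeZero n] (v : HeightOneSpectrum (𝓞 K)) (g : GL (Fin n) (AdeleRing (𝓞 K) K)) :
    vecFinHeight K v (Sum.elim (fun o : Option (Fin n × Fin n) => o.elim 1 fun ij => (g : Matrix (Fin n) (Fin n) (AdeleRing (𝓞 K) K)) ij.1 ij.2)
        (fun ik : Fin n × Fin n => ((g⁻¹ : GL (Fin n) (AdeleRing (𝓞 K) K)) : Matrix (Fin n) (Fin n) (AdeleRing (𝓞 K) K)) ik.1 ik.2) :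
          Option (Fin n × Fin n) ⊕ (Fin n × Fin n) → AdeleRing (𝓞 K) K) =
      GLn.localHeight n K v g := by
  set y : Option (Fin n × Fin n) ⊕ (Fin n × Fin n) → AdeleRing (𝓞 K) K := Sum.elim (fun o : Option (Fin n × Fin n) => o.elim 1 fun ij =>
      (g : Matrix (Fin n) (Fin n) (AdeleRing (𝓞 K) K)) ij.1 ij.2)
    (fun ik : Fin n × Fin n => ((g⁻¹ : GL (Fin n) (AdeleRing (𝓞 K) K)) : Matrix (Fin n) (Fin n) (AdeleRing (𝓞 K) K)) ik.1 ik.2) with hy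
  refine le_antisymm (Finset.sup_le fun c _ => ?_) (Finset.sup_le fun ij _ => sup_le ?_ ?_)
  · rcases c with (_ | ⟨i, j⟩) | ⟨i, k⟩
    · have e : ((1 : AdeleRing (𝓞 K) K).2 v) = 1 := rfl
      show ‖((1 : AdeleRing (𝓞 K) K).2 v)‖₊ ≤ _
      rw [e, nnnorm_one]
      exact GLn.one_le_localHeight v g
    · show ‖(((g : Matrix (Fin n) (Fin n) (AdeleRing (𝓞 K) K)) i j).2 v)‖₊ ≤ _
      rw [← map_adeleEval_coe_apply]
      exact nnnorm_apply_le_sup (Matrix.GeneralLinearGroup.map (AdelicGroupData.adeleEval K v) g) i j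
    · show ‖((((g⁻¹ : GL (Fin n) (AdeleRing (𝓞 K) K)) : Matrix (Fin n) (Fin n) (AdeleRing (𝓞 K) K)) i k).2 v)‖₊ ≤ _
      rw [← map_adeleEval_inv_coe_apply]
      exact nnnorm_inv_apply_le_sup (Matrix.GeneralLinearGroup.map (AdelicGroupData.adeleEval K v) g) i k
  · rw [map_adeleEval_coe_apply]
    exact nnnorm_snd_apply_le_vecFinHeight v y (Sum.inl (some ij))
  · rw [map_adeleEval_inv_coe_apply]
    exact nnnorm_snd_apply_le_vecFinHeight v y (Sum.inr ij)

/-- The vector `(1, g, g⁻¹)` has finite height data (`N ≥ 1`): its finite local heights ARE the `H_v(g)`, which are `1` for almost all `v`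
(★ `GLn.mulSupport_localHeight_finite_holds`). [cite: BorelJacquet1979, §1.2] -/
theorem isHeightFinite_one_entries_inv [NeZero n] (g : GL (Fin n) (AdeleRing (𝓞 K) K)) :
    IsHeightFinite K (Sum.elim (fun o : Option (Fin n × Fin n) => o.elim 1 fun ij => (g : Matrix (Fin n) (Fin n) (AdeleRing (𝓞 K) K)) ij.1 ij.2)
        (fun ik : Fin n × Fin n => ((g⁻¹ : GL (Fin n) (AdeleRing (𝓞 K) K)) : Matrix (Fin n) (Fin n) (AdeleRing (𝓞 K) K)) ik.1 ik.2) :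
          Option (Fin n × Fin n) ⊕ (Fin n × Fin n) → AdeleRing (𝓞 K) K) := by
  unfold IsHeightFinite
  simp_rw [vecFinHeight_one_entries_inv_eq_localHeight]
  exact GLn.mulSupport_localHeight_finite_holds g

/-- `∏ᶠ_v h_v(1, g, g⁻¹) = ∏ᶠ_v H_v(g)` (as real numbers). [cite: BorelJacquet1979, §1.2] -/
theorem finprod_vecFinHeight_one_entries_inv [NeZero n] (g : GL (Fin n) (AdeleRing (𝓞 K) K)) :
    (((∏ᶠ v, vecFinHeight K v (Sum.elim (fun o : Option (Fin n × Fin n) => o.elim 1 fun ij =>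
          (g : Matrix (Fin n) (Fin n) (AdeleRing (𝓞 K) K)) ij.1 ij.2)
        (fun ik : Fin n × Fin n => ((g⁻¹ : GL (Fin n) (AdeleRing (𝓞 K) K)) : Matrix (Fin n) (Fin n) (AdeleRing (𝓞 K) K)) ik.1 ik.2) :
          Option (Fin n × Fin n) ⊕ (Fin n × Fin n) → AdeleRing (𝓞 K) K) : ℝ≥0)) : ℝ) =
      ∏ᶠ v, (GLn.localHeight n K v g : ℝ) := by
  simp_rw [vecFinHeight_one_entries_inv_eq_localHeight]
  exact NNReal.toRealHom.map_finprod_of_injective NNReal.coe_injective _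

end Local

/-! ## §3 The archimedean height against the archimedean part of `h(1, g, g⁻¹)` -/

section Arch

variable {n : ℕ}

/-- **`H_∞(g) ≤ ∏_w ‖(1, g, g⁻¹)‖_w^{mult w}`**: every entry of `g_∞` and of `g_∞⁻¹` is the image `ι((y_c)_∞)` of a coordinate `y_c` of
`y = (1, g, g⁻¹)`, whose sup norm is at most `∏_w ‖y‖_w^{mult w}` (§1; the coordinate `1` makes all archimedean factors `≥ 1`). [cite: BorelJacquet1979, §1.2] -/
theorem archHeight_le_prod_vecArchNorm (g : GL (Fin n) (AdeleRing (𝓞 K) K)) :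
    GLn.archHeight n K g ≤ ∏ w : InfinitePlace K,
      vecArchNorm K w (Sum.elim (fun o : Option (Fin n × Fin n) => o.elim 1 fun ij => (g : Matrix (Fin n) (Fin n) (AdeleRing (𝓞 K) K)) ij.1 ij.2)
        (fun ik : Fin n × Fin n => ((g⁻¹ : GL (Fin n) (AdeleRing (𝓞 K) K)) : Matrix (Fin n) (Fin n) (AdeleRing (𝓞 K) K)) ik.1 ik.2) :
          Option (Fin n × Fin n) ⊕ (Fin n × Fin n) → AdeleRing (𝓞 K) K) ^ w.mult := by
  unfold GLn.archHeight
  refine Finset.sup_le fun ij _ => sup_le ?_ ?_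
  · have e : ((GLn.toMixed n K g : GL (Fin n) (mixedSpace K)) : Matrix (Fin n) (Fin n) (mixedSpace K)) ij.1 ij.2 =
        InfiniteAdeleRing.ringEquiv_mixedSpace K (((g : Matrix (Fin n) (Fin n) (AdeleRing (𝓞 K) K)) ij.1 ij.2).1) := rfl
    rw [e]
    exact nnnorm_ringEquiv_mixedSpace_fst_le_of_apply_eq_one
      (x := (Sum.elim (fun o : Option (Fin n × Fin n) => o.elim 1 fun ij => (g : Matrix (Fin n) (Fin n) (AdeleRing (𝓞 K) K)) ij.1 ij.2)
        (fun ik : Fin n × Fin n => ((g⁻¹ : GL (Fin n) (AdeleRing (𝓞 K) K)) : Matrix (Fin n) (Fin n) (AdeleRing (𝓞 K) K)) ik.1 ik.2) :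
          Option (Fin n × Fin n) ⊕ (Fin n × Fin n) → AdeleRing (𝓞 K) K)) (Sum.inl none) rfl (Sum.inl (some ij))
  · rw [toMixed_inv_coe_apply]
    exact nnnorm_ringEquiv_mixedSpace_fst_le_of_apply_eq_one
      (x := (Sum.elim (fun o : Option (Fin n × Fin n) => o.elim 1 fun ij => (g : Matrix (Fin n) (Fin n) (AdeleRing (𝓞 K) K)) ij.1 ij.2)
        (fun ik : Fin n × Fin n => ((g⁻¹ : GL (Fin n) (AdeleRing (𝓞 K) K)) : Matrix (Fin n) (Fin n) (AdeleRing (𝓞 K) K)) ik.1 ik.2) :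
          Option (Fin n × Fin n) ⊕ (Fin n × Fin n) → AdeleRing (𝓞 K) K)) (Sum.inl none) rfl (Sum.inr ij)

end Arch

/-! ## §4 `‖g‖ ≤ h(1, g, g⁻¹)` -/

section Global

variable {n : ℕ}

/-- **THE BRIDGE `‖g‖ ≤ h(1, g, g⁻¹)`** (`N ≥ 1`): the Borel–Jacquet height ★ `adelicHeightGL` of `g ∈ GL_N(𝔸_K)` is at most the Godement–Garrett
height ★ `vecHeight` of the adelic vector `(1, (g_{ij}), ((g⁻¹)_{ik}))` — the finite parts AGREE (§2) and `H_∞(g) ≤ ∏_w ‖·‖_w^{mult w}` (§3).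
[cite: BorelJacquet1979, §1.2] [cite: Garrett2018, §2.2 (PDF p. 81)] -/
theorem adelicHeightGL_le_vecHeight [NeZero n] (g : GL (Fin n) (AdeleRing (𝓞 K) K)) :
    adelicHeightGL n K g ≤
      (vecHeight K (Sum.elim (fun o : Option (Fin n × Fin n) => o.elim 1 fun ij => (g : Matrix (Fin n) (Fin n) (AdeleRing (𝓞 K) K)) ij.1 ij.2)
        (fun ik : Fin n × Fin n => ((g⁻¹ : GL (Fin n) (AdeleRing (𝓞 K) K)) : Matrix (Fin n) (Fin n) (AdeleRing (𝓞 K) K)) ik.1 ik.2) :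
          Option (Fin n × Fin n) ⊕ (Fin n × Fin n) → AdeleRing (𝓞 K) K) : ℝ) := by
  rw [adelicHeightGL, vecHeight, NNReal.coe_mul, finprod_vecFinHeight_one_entries_inv]
  refine mul_le_mul_of_nonneg_right ?_ (finprod_nonneg fun _ => NNReal.coe_nonneg _)
  exact_mod_cast archHeight_le_prod_vecArchNorm g

end Global

end Summit.HodgeConjecture.HodgeConjecture.Cruxes.HLiu418.K2LiuAdelicHeightGLVsVecHeight

end
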